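import Mathlib.Algebra.BigOperators.Finprod
import Literature.Analysis.FluidPDE.HardSphereDynamicsProofs
import HarnessLib

/-!
# The collision payload of a hard-sphere trajectory

A functional of a curve `γ : ℝ → Config N d X` in the hard-sphere phase space of
`Literature.Analysis.FluidPDE.HardSpherePhaseSpace` / `HardSphereDynamics` (notion
`collisionPayload`; requested by route `CompensatedSlabClusters` of
AtomisticToContinuum/HydrodynamicLimit, whose items inline it verbatim, and by the cards
`apriori-tails-and-rattlers`, `contact-traces-are-bulk`, `relay-race-light-cone`; the companion
notion `slabClusterSize` is `Literature.Analysis.FluidPDE.SlabCluster`):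

* `velocityJump γ t = ∑ i ‖v_i(t) − v_i(t⁻)‖`, the total velocity jump ("kink") of the
  right-continuous curve `γ` at time `t` (`v_i(t⁻)` read off `Function.leftLim γ t`);
* `collisionPayload G ε γ a b = ∑ᶠ t ∈ collisionTimes G ε γ ∩ [a, b], velocityJump γ t`, the
  COLLISION PAYLOAD of `γ` on the window `[a, b]`: Serre's weighted collision count `∑_coll |[v]|`
  (Serre 2024 §1.4 (5), Thm 6 (7), §5: `[v] = v⁺(p) − v⁻(p) = v⁻(q) − v⁺(q)` is the momentum
  exchanged by the colliding pair `(p, q)`; Serre 2021 Thm 1.1), here with both particles of a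
  collision counted, so that a binary collision contributes `2 |[v]|`
  (`sum_norm_collidePair_vel_sub`, `IsHardSphereTrajectory.velocityJump_eq`).

## Main statements

* `collisionPayload_nonneg`; `collisionPayload_eq_sum` (a `Finset` sum once the collision times in
  the window are finite, e.g. `IsHardSphereTrajectory.locFinite`);
  `collisionPayload_eq_zero_of_forall_notMem` (collision-free windows); `collisionPayload_mono`;
* the window splitting `collisionPayload_add_collisionPayload_self`
  (`pay[a,c] + pay[b,b] = pay[a,b] + pay[b,c]`: with closed windows the shared endpoint is counted
  in both halves), `collisionPayload_add` (endpoint not a collision time) and the unconditional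
  subadditivity `collisionPayload_le_add`;
* `collisionPayload_flipVel`, `IsHardSphereTrajectory.collisionPayload_timeReverse`
  (`pay(Tγ)[a,b] = pay(γ)[−b,−a]`) and `collisionPayload_comp_add_right` (time shift
  `pay(γ(· + c))[a,b] = pay(γ)[a+c,b+c]`): invariance under the velocity flip, time reversal and
  the behaviour under time translation (orbits of a flow);
* `IsHardSphereTrajectory.velocityJump_eq` (`= 2‖δv_i‖` at a binary collision) with
  `norm_collidePair_vel_sub` (`‖δv_i‖ = |⟪v_i − v_j, n⟫| / ‖n‖`), `velocityJump_pos` /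
  `collisionPayload_pos` (collisions of a trajectory are never grazing: positive payload), and
  `IsHardSphereTrajectory.collisionPayload_eq_finsum_Icc` (restricting the sum to collision times
  loses no jump).

## Design choices

* The body of `collisionPayload` is literally the expression inlined in the route items (`finsum`
  over `collisionTimes G ε γ ∩ Set.Icc a b` of `∑ i, ‖(γ t i).2 - (Function.leftLim γ t i).2‖`),
  so that those items restate over the definition by `rfl` (`collisionPayload_eq`).
* It is a `finsum`: junk value `0` when infinitely many collision times of the window carry a
  nonzero jump (never the case on a hard-sphere trajectory, `locFinite`).
* Closed windows `Icc`, as requested; additivity over adjacent windows therefore carries the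
  endpoint term `collisionPayload G ε γ b b` (`= velocityJump γ b`, or `0`).
* Trajectory statements assume what `HardSphereDynamicsProofs` assumes: Hausdorff positions
  (`T2Space X`: unique left limits) and, where right limits of `leftLim γ` or continuity of the
  velocities away from collisions are used, continuous translations `hG`.
* Not here: Serre's payload BOUND itself (to be vendored as a named fact), energy bounds on single
  jumps, measurability in the initial datum along a `HardSphereFlow`.

## References

* D. Serre, *Compensated integrability on tori; a priori estimate for space-periodic gas flows*,
  C. R. Math. 362 (2024) 1425–1444, §1.4 (5)–(7), Thm 6, §5.
* D. Serre, *Hard spheres dynamics: weak vs strong collisions*, ARMA 240 (2021), Thm 1.1.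
* C. Cercignani, R. Illner, M. Pulvirenti, *The Mathematical Theory of Dilute Gases* (1994), §4.2.
-/

open Set Filter Topology Function
open scoped InnerProductSpace

namespace Literature.Analysis.FluidPDE

noncomputable section

section Kinetic

variable {d : Type*} [Fintype d] {X : Type*} {N : ℕ}

/-! ## Velocity jumps of a single elastic collision -/

section Collision

variable {G : Geometry d X} {i j : Fin N}

/-- In the elastic collision of the pair `(i, j)` the velocity change of particle `i` has norm
`|⟪v_i - v_j, n⟫| / ‖n‖`, `n = x_i - x_j` the (unnormalised) impact direction — Serre's `|[v]|`
for the unit normal `n / ‖n‖` (Serre 2024 §5; GST 2013 (1.1.3)). For `n = 0` both sides vanish.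
[cite: Serre2024, §5] -/
theorem norm_collidePair_vel_sub (hij : i ≠ j) (z : Config N d X) :
    ‖(collidePair G i j z i).2 - (z i).2‖ =
      |⟪(z i).2 - (z j).2, G.sepVec (z i).1 (z j).1⟫_ℝ| / ‖G.sepVec (z i).1 (z j).1‖ := by
  rw [collidePair_apply_left hij]
  simp only [reflectVel]
  rw [sub_sub_cancel_left, norm_neg, norm_smul, Real.norm_eq_abs, abs_div, abs_pow, abs_norm]
  by_cases hn : G.sepVec (z i).1 (z j).1 = 0
  · simp [hn]
  · rw [div_mul_eq_mul_div, pow_two, mul_div_mul_right _ _ (norm_ne_zero_iff.2 hn)]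

/-- The total velocity jump of a binary elastic collision is twice the velocity change of either
particle, `∑_k ‖v_k' - v_k‖ = 2 ‖v_i' - v_i‖`: the pair exchanges the momenta `-[v]`, `[v]` and
the other particles are untouched (Serre 2024 §5). [cite: Serre2024, §5] -/
theorem sum_norm_collidePair_vel_sub (hij : i ≠ j) (z : Config N d X) :
    ∑ k, ‖(collidePair G i j z k).2 - (z k).2‖ = 2 * ‖(collidePair G i j z i).2 - (z i).2‖ := by
  rw [Finset.sum_eq_add_of_mem i j (Finset.mem_univ i) (Finset.mem_univ j) hij fun k _ hk => by
    rw [collidePair_apply_of_ne hk.1 hk.2, sub_self, norm_zero]]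
  rw [collidePair_apply_left hij, collidePair_apply_right]
  simp only [reflectVel]
  rw [sub_sub_cancel_left, add_sub_cancel_left, norm_neg, two_mul]

/-- The velocity flip does not change the collision times of a curve. [folklore] -/
theorem collisionTimes_flipVel (G : Geometry d X) (ε : ℝ) (γ : ℝ → Config N d X) :
    collisionTimes G ε (fun t => flipVel (γ t)) = collisionTimes G ε γ := by
  ext t
  simp only [mem_collisionTimes, flipVel_mem_contactSet_iff]

/-- The collision times of a time-shifted curve (definitional). [folklore] -/
theorem collisionTimes_comp_add_right (G : Geometry d X) (ε : ℝ) (γ : ℝ → Config N d X)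
    (c : ℝ) : collisionTimes G ε (fun t => γ (t + c)) = (· + c) ⁻¹' collisionTimes G ε γ :=
  rfl

end Collision

/-! ## The velocity jump and the collision payload -/

section Payload

variable [TopologicalSpace X]

/-- The total VELOCITY JUMP of the curve `γ` at time `t`: `∑_i ‖v_i(t) - v_i(t⁻)‖`, where
`v_i(t⁻)` is read off the strict left limit `Function.leftLim γ t` (the curve is meant to be
right-continuous, as hard-sphere trajectories are; where `γ` has no left limit Mathlib's
`leftLim` is the value and the jump is `0`). On a hard-sphere trajectory this is `2 |[v]|` at a
collision time and `0` elsewhere (Serre 2024 §5, the "kinks" of the broken lines).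
[cite: Serre2024, §5] -/
def velocityJump (γ : ℝ → Config N d X) (t : ℝ) : ℝ :=
  ∑ i, ‖(γ t i).2 - (Function.leftLim γ t i).2‖

/-- Unfolding lemma for `velocityJump`. [folklore] -/
theorem velocityJump_eq (γ : ℝ → Config N d X) (t : ℝ) :
    velocityJump γ t = ∑ i, ‖(γ t i).2 - (Function.leftLim γ t i).2‖ :=
  rfl

/-- Velocity jumps are nonnegative. [folklore] -/
theorem velocityJump_nonneg (γ : ℝ → Config N d X) (t : ℝ) : 0 ≤ velocityJump γ t :=
  Finset.sum_nonneg fun _ _ => norm_nonneg _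

/-- No jump where the left limit is the value. [folklore] -/
theorem velocityJump_eq_zero_of_leftLim_eq {γ : ℝ → Config N d X} {t : ℝ}
    (h : Function.leftLim γ t = γ t) : velocityJump γ t = 0 := by
  simp [velocityJump, h]

/-- No jump at a time where the curve is continuous from the left (Hausdorff positions).
[folklore] -/
theorem velocityJump_eq_zero_of_continuousWithinAt [T2Space X] {γ : ℝ → Config N d X} {t : ℝ}
    (h : ContinuousWithinAt γ (Iic t) t) : velocityJump γ t = 0 :=
  velocityJump_eq_zero_of_leftLim_eq h.leftLim_eq

/-- Left limits commute with the velocity flip (a homeomorphism of phase space; Hausdorff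
positions). [folklore] -/
theorem leftLim_flipVel [T2Space X] (γ : ℝ → Config N d X) (t : ℝ) :
    Function.leftLim (fun s => flipVel (γ s)) t = flipVel (Function.leftLim γ t) := by
  by_cases hγ : ∃ y, Tendsto γ (𝓝[<] t) (𝓝 y)
  · obtain ⟨y, hy⟩ := hγ
    have h1 : Tendsto (fun s => flipVel (γ s)) (𝓝[<] t) (𝓝 (flipVel y)) :=
      (continuous_flipVel.tendsto y).comp hy
    rw [leftLim_eq_of_tendsto hy, leftLim_eq_of_tendsto h1]
  · rw [leftLim_eq_of_not_tendsto _ hγ, leftLim_eq_of_not_tendsto]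
    rintro ⟨y, hy⟩
    refine hγ ⟨flipVel y, ?_⟩
    have h2 := (continuous_flipVel.tendsto y).comp hy
    simpa only [Function.comp_def, flipVel_flipVel] using h2

/-- The velocity flip does not change velocity jumps (Hausdorff positions). [folklore] -/
theorem velocityJump_flipVel [T2Space X] (γ : ℝ → Config N d X) (t : ℝ) :
    velocityJump (fun s => flipVel (γ s)) t = velocityJump γ t := by
  simp only [velocityJump, leftLim_flipVel, flipVel_apply, neg_sub_neg]
  exact Finset.sum_congr rfl fun i _ => norm_sub_rev _ _

/-- Left limits of a time-shifted curve (Hausdorff positions). [folklore] -/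
theorem leftLim_comp_add_right [T2Space X] (γ : ℝ → Config N d X) (c t : ℝ) :
    Function.leftLim (fun s => γ (s + c)) t = Function.leftLim γ (t + c) := by
  have hmap : map (· + c) (𝓝[<] t) = 𝓝[<] (t + c) := by
    have h := (Homeomorph.addRight c).isEmbedding.map_nhdsWithin_eq (Iio t) t
    simp only [Homeomorph.coe_addRight, Set.image_add_const_Iio] at h
    exact h
  have key : ∀ y, Tendsto (fun s => γ (s + c)) (𝓝[<] t) (𝓝 y) ↔
      Tendsto γ (𝓝[<] (t + c)) (𝓝 y) := fun y => by
    rw [← hmap, tendsto_map'_iff, Function.comp_def]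
  by_cases hγ : ∃ y, Tendsto γ (𝓝[<] (t + c)) (𝓝 y)
  · obtain ⟨y, hy⟩ := hγ
    rw [leftLim_eq_of_tendsto hy, leftLim_eq_of_tendsto ((key y).2 hy)]
  · rw [leftLim_eq_of_not_tendsto _ hγ, leftLim_eq_of_not_tendsto]
    exact fun ⟨y, hy⟩ => hγ ⟨y, (key y).1 hy⟩

/-- Velocity jumps of a time-shifted curve (Hausdorff positions). [folklore] -/
theorem velocityJump_comp_add_right [T2Space X] (γ : ℝ → Config N d X) (c t : ℝ) :
    velocityJump (fun s => γ (s + c)) t = velocityJump γ (t + c) := by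
  simp only [velocityJump, leftLim_comp_add_right]

/-- The COLLISION PAYLOAD of the curve `γ` on the time window `[a, b]`: the sum over the collision
times `t ∈ collisionTimes G ε γ ∩ [a, b]` of the total velocity jump `∑_i ‖v_i(t) - v_i(t⁻)‖` —
Serre's weighted collision count `∑_coll |[v]|` of the window (Serre 2024 §1.4 (5) and Thm 6 (7);
Serre 2021 Thm 1.1), each binary collision contributing `2 |[v]|` since both particles are
counted. A `finsum`: junk value `0` if infinitely many collision times of the window carry a
nonzero jump (excluded on hard-sphere trajectories, `IsHardSphereTrajectory.locFinite`).
[cite: Serre2024, §1.4 (5) and Thm 6 (7)] -/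
def collisionPayload (G : Geometry d X) (ε : ℝ) (γ : ℝ → Config N d X) (a b : ℝ) : ℝ :=
  ∑ᶠ t ∈ collisionTimes G ε γ ∩ Set.Icc a b, ∑ i, ‖(γ t i).2 - (Function.leftLim γ t i).2‖

variable {G : Geometry d X} {ε : ℝ} {γ : ℝ → Config N d X} {a b c : ℝ}

/-- The collision payload is the `finsum` of the velocity jumps over the collision times of the
window (definitional unfolding). [folklore] -/
theorem collisionPayload_eq (G : Geometry d X) (ε : ℝ) (γ : ℝ → Config N d X) (a b : ℝ) :
    collisionPayload G ε γ a b = ∑ᶠ t ∈ collisionTimes G ε γ ∩ Icc a b, velocityJump γ t :=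
  rfl

/-- The collision payload is nonnegative. [folklore] -/
theorem collisionPayload_nonneg (G : Geometry d X) (ε : ℝ) (γ : ℝ → Config N d X) (a b : ℝ) :
    0 ≤ collisionPayload G ε γ a b :=
  finsum_nonneg fun t => finsum_nonneg fun _ => velocityJump_nonneg γ t

/-- With finitely many collision times in the window the payload is a finite sum. [folklore] -/
theorem collisionPayload_eq_sum (hfin : (collisionTimes G ε γ ∩ Icc a b).Finite) :
    collisionPayload G ε γ a b = ∑ t ∈ hfin.toFinset, velocityJump γ t :=
  finsum_mem_eq_finite_toFinset_sum _ hfin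

/-- A window free of collision times carries no payload. [folklore] -/
theorem collisionPayload_eq_zero_of_forall_notMem
    (h : ∀ t ∈ Icc a b, t ∉ collisionTimes G ε γ) : collisionPayload G ε γ a b = 0 :=
  finsum_mem_eq_zero_of_forall_eq_zero fun t ht => absurd ht.1 (h t ht.2)

/-- An empty window (`b < a`) carries no payload. [folklore] -/
theorem collisionPayload_eq_zero_of_lt (hba : b < a) : collisionPayload G ε γ a b = 0 :=
  collisionPayload_eq_zero_of_forall_notMem fun _ ht _ => (not_le.2 hba (ht.1.trans ht.2)).elim

/-- The payload of the one-point window at a collision time is the velocity jump there.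
[folklore] -/
theorem collisionPayload_self_of_mem (hb : b ∈ collisionTimes G ε γ) :
    collisionPayload G ε γ b b = velocityJump γ b := by
  rw [collisionPayload_eq, Icc_self, inter_eq_right.2 (singleton_subset_iff.2 hb),
    finsum_mem_singleton]

/-- The payload of the one-point window at a non-collision time vanishes. [folklore] -/
theorem collisionPayload_self_of_notMem (hb : b ∉ collisionTimes G ε γ) :
    collisionPayload G ε γ b b = 0 :=
  collisionPayload_eq_zero_of_forall_notMem fun t ht => by
    rw [Icc_self, mem_singleton_iff] at ht
    rwa [ht]

/-- Monotonicity of the payload in the window, given finitely many collision times in the larger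
window (otherwise the larger payload may be the junk value `0`). [folklore] -/
theorem collisionPayload_mono {a' b' : ℝ} (hfin : (collisionTimes G ε γ ∩ Icc a' b').Finite)
    (ha : a' ≤ a) (hb : b ≤ b') : collisionPayload G ε γ a b ≤ collisionPayload G ε γ a' b' := by
  have hsub : collisionTimes G ε γ ∩ Icc a b ⊆ collisionTimes G ε γ ∩ Icc a' b' :=
    inter_subset_inter_right _ (Icc_subset_Icc ha hb)
  rw [collisionPayload_eq_sum (hfin.subset hsub), collisionPayload_eq_sum hfin]
  exact Finset.sum_le_sum_of_subset_of_nonneg (Set.Finite.toFinset_subset_toFinset.2 hsub)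
    fun t _ _ => velocityJump_nonneg γ t

omit [TopologicalSpace X] in
/-- `[a, b] ∪ [b, c] = [a, c]` at the level of collision times. [folklore] -/
private theorem collisionTimes_inter_Icc_union (hab : a ≤ b) (hbc : b ≤ c) :
    collisionTimes G ε γ ∩ Icc a b ∪ collisionTimes G ε γ ∩ Icc b c =
      collisionTimes G ε γ ∩ Icc a c := by
  rw [← inter_union_distrib_left, Icc_union_Icc_eq_Icc hab hbc]

omit [TopologicalSpace X] in
/-- `[a, b] ∩ [b, c] = [b, b]` at the level of collision times. [folklore] -/
private theorem collisionTimes_inter_Icc_inter (hab : a ≤ b) (hbc : b ≤ c) :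
    collisionTimes G ε γ ∩ Icc a b ∩ (collisionTimes G ε γ ∩ Icc b c) =
      collisionTimes G ε γ ∩ Icc b b := by
  rw [← inter_inter_distrib_left, Icc_inter_Icc, sup_of_le_right hab, inf_of_le_left hbc]

/-- Splitting a window at `b ∈ [a, c]`: `pay[a,c] + pay[b,b] = pay[a,b] + pay[b,c]`. With closed
windows the shared endpoint `b` is counted in both halves, and `pay[b,b]` is `velocityJump γ b` or
`0` according as `b` is a collision time or not (`collisionPayload_self_of_mem`,
`collisionPayload_self_of_notMem`); needs finitely many collision times in `[a, c]`. [folklore] -/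
theorem collisionPayload_add_collisionPayload_self (hab : a ≤ b) (hbc : b ≤ c)
    (hfin : (collisionTimes G ε γ ∩ Icc a c).Finite) :
    collisionPayload G ε γ a c + collisionPayload G ε γ b b =
      collisionPayload G ε γ a b + collisionPayload G ε γ b c := by
  simp only [collisionPayload_eq]
  rw [← collisionTimes_inter_Icc_union hab hbc, ← collisionTimes_inter_Icc_inter hab hbc]
  exact finsum_mem_union_inter
    (hfin.subset (inter_subset_inter_right _ (Icc_subset_Icc_right hbc)))
    (hfin.subset (inter_subset_inter_right _ (Icc_subset_Icc_left hab)))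

/-- Additivity of the payload over adjacent windows whose common endpoint is not a collision time
(finitely many collision times in the union). [folklore] -/
theorem collisionPayload_add (hab : a ≤ b) (hbc : b ≤ c)
    (hfin : (collisionTimes G ε γ ∩ Icc a c).Finite) (hb : b ∉ collisionTimes G ε γ) :
    collisionPayload G ε γ a b + collisionPayload G ε γ b c = collisionPayload G ε γ a c := by
  rw [← collisionPayload_add_collisionPayload_self hab hbc hfin,
    collisionPayload_self_of_notMem hb, add_zero]

/-- Subadditivity of the payload over adjacent windows, unconditionally. [folklore] -/
theorem collisionPayload_le_add (hab : a ≤ b) (hbc : b ≤ c) :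
    collisionPayload G ε γ a c ≤ collisionPayload G ε γ a b + collisionPayload G ε γ b c := by
  by_cases hfin : (collisionTimes G ε γ ∩ Icc a c ∩ support (velocityJump γ)).Finite
  · have key : collisionPayload G ε γ a c + collisionPayload G ε γ b b =
        collisionPayload G ε γ a b + collisionPayload G ε γ b c := by
      simp only [collisionPayload_eq]
      rw [← collisionTimes_inter_Icc_union hab hbc, ← collisionTimes_inter_Icc_inter hab hbc]
      exact finsum_mem_union_inter'
        (hfin.subset (inter_subset_inter_left _
          (inter_subset_inter_right _ (Icc_subset_Icc_right hbc))))
        (hfin.subset (inter_subset_inter_left _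
          (inter_subset_inter_right _ (Icc_subset_Icc_left hab))))
    linarith [collisionPayload_nonneg G ε γ b b]
  · rw [collisionPayload_eq, finsum_mem_eq_zero_of_infinite hfin]
    exact add_nonneg (collisionPayload_nonneg G ε γ a b) (collisionPayload_nonneg G ε γ b c)

/-- The collision payload is invariant under the velocity flip (Hausdorff positions). [folklore] -/
theorem collisionPayload_flipVel [T2Space X] (G : Geometry d X) (ε : ℝ) (γ : ℝ → Config N d X)
    (a b : ℝ) :
    collisionPayload G ε (fun t => flipVel (γ t)) a b = collisionPayload G ε γ a b := by
  rw [collisionPayload_eq, collisionPayload_eq, collisionTimes_flipVel]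
  exact finsum_mem_congr rfl fun t _ => velocityJump_flipVel γ t

/-- The payload of a time-shifted curve on `[a, b]` is the payload on the shifted window
`[a + c, b + c]` — e.g. along a hard-sphere flow, where `t ↦ Φ_{t+c} z` is the orbit of `Φ_c z`
(Hausdorff positions). [folklore] -/
theorem collisionPayload_comp_add_right [T2Space X] (G : Geometry d X) (ε : ℝ)
    (γ : ℝ → Config N d X) (c a b : ℝ) :
    collisionPayload G ε (fun t => γ (t + c)) a b = collisionPayload G ε γ (a + c) (b + c) := by
  rw [collisionPayload_eq, collisionPayload_eq, collisionTimes_comp_add_right]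
  refine finsum_mem_eq_of_bijOn (· + c) ⟨?_, (add_left_injective c).injOn, ?_⟩ fun t _ =>
    velocityJump_comp_add_right γ c t
  · rintro t ⟨ht, hta, htb⟩
    exact ⟨ht, by linarith, by linarith⟩
  · rintro s ⟨hs, hsa, hsb⟩
    exact ⟨s - c, ⟨by simpa using hs, by linarith, by linarith⟩, sub_add_cancel s c⟩

namespace IsHardSphereTrajectory

variable [T2Space X]

omit [T2Space X] in
/-- On a hard-sphere trajectory the payload of any window is a finite sum over its finitely many
collision times (`locFinite`). [folklore] -/
theorem collisionPayload_eq_sum (h : IsHardSphereTrajectory G ε N γ) (a b : ℝ) :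
    collisionPayload G ε γ a b = ∑ t ∈ (h.locFinite a b).toFinset, velocityJump γ t :=
  FluidPDE.collisionPayload_eq_sum (h.locFinite a b)

/-- At a collision time of a hard-sphere trajectory the total velocity jump is twice the velocity
change of either colliding particle, `2 |[v]|` (Serre 2024 §5; Hausdorff positions, so that the
left limit is the pre-collisional configuration of the `binary` clause). [cite: Serre2024, §5] -/
theorem velocityJump_eq (h : IsHardSphereTrajectory G ε N γ) {t : ℝ} {i j : Fin N} (hij : i ≠ j)
    (ht : γ t ∈ contactSet G N ε i j) :
    velocityJump γ t = 2 * ‖(γ t i).2 - (Function.leftLim γ t i).2‖ := by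
  obtain ⟨-, hγ⟩ := h.eq_collidePair_leftLim hij ht
  rw [velocityJump, hγ]
  exact sum_norm_collidePair_vel_sub hij _

/-- Every collision of a hard-sphere trajectory carries a positive velocity jump: the colliding
pair is incoming, never grazing, so `[v] ≠ 0`. [folklore] -/
theorem velocityJump_pos (h : IsHardSphereTrajectory G ε N γ) {t : ℝ} {i j : Fin N} (hij : i ≠ j)
    (ht : γ t ∈ contactSet G N ε i j) : 0 < velocityJump γ t := by
  obtain ⟨hin, hγ⟩ := h.eq_collidePair_leftLim hij ht
  rw [h.velocityJump_eq hij ht, hγ, norm_collidePair_vel_sub hij]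
  have hne : ⟪(Function.leftLim γ t i).2 - (Function.leftLim γ t j).2,
      G.sepVec (Function.leftLim γ t i).1 (Function.leftLim γ t j).1⟫_ℝ ≠ 0 := by
    rw [real_inner_comm]
    exact hin.ne
  have hn : G.sepVec (Function.leftLim γ t i).1 (Function.leftLim γ t j).1 ≠ 0 := fun h0 =>
    hne (by rw [h0, inner_zero_right])
  exact mul_pos two_pos (div_pos (abs_pos.2 hne) (norm_pos_iff.2 hn))

/-- Hence a window of a hard-sphere trajectory containing a collision time carries a positive
payload. [folklore] -/
theorem collisionPayload_pos (h : IsHardSphereTrajectory G ε N γ) {t : ℝ} {i j : Fin N}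
    (hij : i ≠ j) (ht : γ t ∈ contactSet G N ε i j) (htab : t ∈ Icc a b) :
    0 < collisionPayload G ε γ a b := by
  rw [h.collisionPayload_eq_sum a b]
  refine lt_of_lt_of_le (h.velocityJump_pos hij ht) (Finset.single_le_sum
    (fun s _ => velocityJump_nonneg γ s) ?_)
  exact (Set.Finite.mem_toFinset _).2 ⟨⟨i, j, hij, ht⟩, htab⟩

/-- Away from its collision times a hard-sphere trajectory has no velocity jump (continuous
translations, Hausdorff positions). [folklore] -/
theorem velocityJump_eq_zero (h : IsHardSphereTrajectory G ε N γ)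
    (hG : ∀ x : X, Continuous (G.translate x)) {t : ℝ} (ht : t ∉ collisionTimes G ε γ) :
    velocityJump γ t = 0 :=
  velocityJump_eq_zero_of_leftLim_eq (h.leftLim_eq_of_not_mem hG ht)

/-- Hence the payload of a window is the sum of ALL the velocity jumps in the window: restricting
to collision times loses nothing. [folklore] -/
theorem collisionPayload_eq_finsum_Icc (h : IsHardSphereTrajectory G ε N γ)
    (hG : ∀ x : X, Continuous (G.translate x)) (a b : ℝ) :
    collisionPayload G ε γ a b = ∑ᶠ t ∈ Icc a b, velocityJump γ t := by
  rw [collisionPayload_eq]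
  refine finsum_mem_inter_support_eq _ _ _ (Set.ext fun t => ?_)
  simp only [mem_inter_iff, mem_support]
  constructor
  · rintro ⟨⟨-, hI⟩, hne⟩
    exact ⟨hI, hne⟩
  · rintro ⟨hI, hne⟩
    exact ⟨⟨by_contra fun hnt => hne (h.velocityJump_eq_zero hG hnt), hI⟩, hne⟩

/-- The velocity jumps of the time reversal are those of the trajectory at the reversed times: the
new value at `t` is the flip of the old left limit at `-t`, the new left limit the flip of the old
value (continuous translations, Hausdorff positions). [folklore] -/
theorem velocityJump_timeReverse (h : IsHardSphereTrajectory G ε N γ)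
    (hG : ∀ x : X, Continuous (G.translate x)) (t : ℝ) :
    velocityJump (FluidPDE.timeReverse γ) t = velocityJump γ (-t) := by
  have hl : Function.leftLim (FluidPDE.timeReverse γ) t = flipVel (γ (-t)) := by
    refine leftLim_eq_of_tendsto ?_
    change Tendsto (fun t' => flipVel (Function.leftLim γ (-t'))) (𝓝[<] t)
      (𝓝 (flipVel (γ (-t))))
    exact (continuous_flipVel.tendsto _).comp
      ((h.tendsto_leftLim_nhdsGT hG (-t)).comp tendsto_neg_nhdsLT)
  simp only [velocityJump, hl, timeReverse_apply, flipVel_apply, neg_sub_neg]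

/-- The collision payload is invariant under time reversal: the payload of the reversed trajectory
on `[a, b]` is the payload of the trajectory on `[-b, -a]` (reversibility, CIP 1994 §4.2;
continuous translations, Hausdorff positions). [folklore] -/
theorem collisionPayload_timeReverse (h : IsHardSphereTrajectory G ε N γ)
    (hG : ∀ x : X, Continuous (G.translate x)) (a b : ℝ) :
    collisionPayload G ε (FluidPDE.timeReverse γ) a b = collisionPayload G ε γ (-b) (-a) := by
  rw [collisionPayload_eq, collisionPayload_eq]
  refine finsum_mem_eq_of_bijOn Neg.neg ⟨?_, neg_injective.injOn, ?_⟩ fun t _ =>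
    h.velocityJump_timeReverse hG t
  · rintro t ⟨ht, hta, htb⟩
    exact ⟨(h.mem_collisionTimes_timeReverse hG).1 ht, neg_le_neg htb, neg_le_neg hta⟩
  · rintro s ⟨hs, hsb, hsa⟩
    refine ⟨-s, ⟨(h.mem_collisionTimes_timeReverse hG).2 (by simpa using hs), ?_, ?_⟩, neg_neg s⟩
    · linarith
    · linarith

end IsHardSphereTrajectory

end Payload

end Kinetic

end

end Literature.Analysis.FluidPDE
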